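import Summits.QuantumFields.QCD.Theses.TransparentRPWall
import HarnessLib.Audit

/-!
# `WallDiagonalRP` — the crux-strategist's BC2 REDIRECT: assembly of the three pieces (kernel-checked)

Crux `stmt-QuantumFields-10466` (`TransparentRPWall.WallDiagonalRP`, sub `QCD`, route `route-QuantumFields-TransparentRPWall`,
re-audit bin RESTATED).  Since route rev 20 (2026-08-17) the node is DERIVED from three route items on three different objects:

* `CoverWallRP` (stmt-QuantumFields-17995, crux r3) — EXACT swap reflection positivity of WALL-MODIFIED lattice QCD on the FILS 45°
  cover `T̃_{2L_k+1}` (finite-dimensional Grassmann–Haar statement read on smeared species strings; named-approximant form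
  `∀ Λ, Λ = wall functional → eventually Gram-positive`);
* `WallTransparency` (stmt-QuantumFields-17994, crux r2, THE BET) — the wall approximants, BY NAME (`∃ Λ, Λ = wall functional ∧ …`),
  are `1` in degree `0` and converge to the SAME labelled family `S` as the honest `qcdLatticeSchwinger` on compact disjoint real tensors;
* `DiagonalRPClosure` (stmt-QuantumFields-17996, support r9, provable now) — MODEL-BLIND: normalised `S` + proper-hypercubic invariance +
  any approximants with (0),(1),(2) ⇒ E2 of the pull-back by every diagonal frame.

`WallDiagonalRP_of_pieces` below is VERBATIM the `have hWall` of the route's deciding theorem `closes` (rev 20/21): an ∃-elimination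
that names the wall approximants, then modus ponens (flag `trivial_seam` in the ruling's sense — the content sits in the pieces, whose
registered skeletons are `Lines/{CoverWallRP,WallTransparency,DiagonalRPClosure}_birth.lean`; certificate `BC2-REDIRECT.md`).
A prover may land this file's theorem as `Summits/QuantumFields/QCD/Theorems/TransparentRPWallWallDiagonalRPSplit.lean --supports stmt-QuantumFields-10466`.
-/

namespace Summit.QuantumFields.QCD.Cruxes.WallDiagonalRP.Split

open Summit.QuantumFields.QCD.Theses.TransparentRPWall

/-- **Assembly of the redirect (kernel-checked, axioms propext / Classical.choice / Quot.sound):** the three pieces imply the crux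
BY NAME — `WallTransparency` names the wall approximants `Λ₀` and gives their normalisation and convergence to `S`, `CoverWallRP` their
eventual swap Gram positivity, `DiagonalRPClosure` (with E0 and the proper-hypercubic clause of `W`) concludes in every diagonal frame. -/
theorem WallDiagonalRP_of_pieces (hR : CoverWallRP) (hT : WallTransparency) (hC : DiagonalRPClosure) : WallDiagonalRP := by
  intro Nf sch S hW R a b ha hb hRe0
  obtain ⟨⟨hnorm, hherm, hgrowth, hrp, hsymm, hclus, -, hhyp⟩, ⟨hAF, hbr, hconv⟩, Δ, hΔ, hgap, hlat⟩ := hW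
  obtain ⟨Λ₀, hΛ, h0, hcv⟩ :=
    hT Nf sch S ⟨hnorm, hherm, hgrowth, hrp, hsymm, hclus⟩ ⟨hAF, hbr, hconv⟩ ⟨Δ, hΔ, hgap, hlat⟩
  exact hC _ S Λ₀ hnorm hhyp h0 hcv (hR Nf sch hAF hbr ⟨Δ, hΔ, hlat⟩ Λ₀ hΛ) R a b ha hb hRe0

/-- The crux from the three pieces as hypotheses (shape for the audit: concludes the route decl BY NAME). -/
theorem WallDiagonalRP_of : CoverWallRP → WallTransparency → DiagonalRPClosure → WallDiagonalRP :=
  WallDiagonalRP_of_pieces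

end Summit.QuantumFields.QCD.Cruxes.WallDiagonalRP.Split
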